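import Summits.AnomalousDissipation.AnomalousDissipation.Theorems.SolenoidalFractalHomogenisationLagrangianStepCellLawVSlowGraphTracking
import HarnessLib

/-!
# K1L `LagrangianRenormalisationStep(Design)` (K1L_D, stmt-AnomalousDissipation-27980; aside 24912), stub `stub_cellLawV0_IS`
# — the ABSTRACT SLOW-GRAPH LEVER, part 7: slow-amplitude tracking with the COERCIVITY OF THE AVERAGED GENERATOR and the A PRIORI BOUND as hypotheses
# (helper; `--supports stmt-AnomalousDissipation-27980`; word-independent)

Summits-side helper file of route `SolenoidalFractalHomogenisation` (planner ad-ideate-p5's STUB-PLAN for `stub_cellLawV` §1 (V), tenure D24-1; crux idea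
`chang-slow-graph`), companion of part 6 `…SlowGraphTracking` (G6 `slow_tracking`, same proof).  WHY A SECOND FORM.  G6 derives the coercivity of the averaged
reduced generator `Ḡ = −(1/P)∫₀ᴾ (A₁₁ + A₁₂M)` from a dissipative slow block `⟪A₁₁v,v⟫ ≤ −a₀‖v‖²` with `a₀ > δr`.  In the Bloch-fibred cell system of
`SlowVectorClauseNoExF` this is the WRONG regime: `A₁₁ = −4π²|ξ|²·(𝔸-symbol) ∼ ν|ξ|²` while the graph term `A₁₂L ∼ |ξ|²/ν` dominates — it IS the
homogenised eddy viscosity `(c/ν)Φν(𝔸/ν)` — so `Ḡ`'s coercivity is the positivity of the effective tensor, i.e. the (W)-half / D1 identification, an INPUT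
of the (V) proof and not a consequence of the block bounds.  `slow_tracking_of_coercive` therefore takes `r_lo‖v‖² ≤ ⟪Ḡv,v⟫` and the a priori bound
`‖x s‖ ≤ Mx` (energy inequality of the cell solution, purely slow datum) as hypotheses — the exact shape of ad-lit's `PeriodicAveraging.norm_sub_exp_apply_le`
— and concludes `‖x t − e^{−tḠ}x 0‖ ≤ Mx·(η(min(t,1/r_lo) + P) + L_g P(1 + (2G_n + L_g)/r_lo))`, `η = δr/(κP)`, `L_g = 2(s₀ + δr)`, `G_n = s₀ + δr`,
`r = 2δ/(γ−s₀)`, `κ = (γ−s₀)(1−r²)`.  Ingredients as in part 6: G0 + G2 (reduction to the graph from the empty graph), G1, G4 (transient `re^{−κt}`),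
G5′ (`M`), periodic window means, Besjes/SVM averaging.  No named facts, no new definitions, no sorry.  Infrastructure for route-1's rung leaf F-D1.A0
(frontier FORMAL rung); NOT a proof of the stub, of the crux, of Onsager's conjecture or of anomalous dissipation.  Prover seat `ad-k1l-cellLawV-w1` g3, 2026-08-28.
-/

set_option linter.dupNamespace false

noncomputable section

namespace Summit.AnomalousDissipation.AnomalousDissipation.Theorems.SolenoidalFractalHomogenisation.LagrangianStep

namespace SlowGraph

open Set Filter Topology Metric MeasureTheory intervalIntegral
open scoped InnerProductSpace NNReal

/-! ## §15 G6′ — tracking with coercivity of `Ḡ` and the a priori bound as hypotheses -/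

section TrackingCoercive

/-- **G6′ — SLOW-AMPLITUDE TRACKING, with the COERCIVITY OF `Ḡ` and the A PRIORI BOUND as hypotheses (the form the cell problem consumes).**
Block system `ẋ = A₁₁x + A₁₂z`, `ż = A₂₁x + A₂₂z` on `[0, T)` with coefficients continuous on `[0, T]` and `P`-periodic there (`0 < P ≤ T`), G1's
hypotheses (`γ`-dissipative fast block, `‖A₁₁‖ ≤ s₀ < γ`, couplings `≤ δ`, `8δ² ≤ (γ−s₀)²`; `r = 2δ/(γ−s₀)`, `κ = (γ−s₀)(1−r²)`), a periodic Riccati graph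
`M` in the ball (G5′), the EMPTY-GRAPH datum `z 0 = 0`, an a priori bound `‖x s‖ ≤ Mx` on `[0, T]`, and COERCIVITY `r_lo‖v‖² ≤ ⟪Ḡv, v⟫` of the averaged
reduced generator `Ḡ = −(1/P)∫₀ᴾ (A₁₁ s + A₁₂ s ∘ M s) ds` (in the cell regime this is the positivity of the effective tensor — the graph term
`A₁₂L ∼ |ξ|²/ν` dominates the bare `A₁₁ ∼ ν|ξ|²`, so it cannot be read off `A₁₁` as in `slow_tracking`).  Then for every `t ∈ [0, T)`:
`‖x t − e^{−tḠ} x 0‖ ≤ Mx·(η (min(t, 1/r_lo) + P) + L_g P (1 + (2G_n + L_g)/r_lo))`, `η = δr/(κP)`, `L_g = 2(s₀ + δr)`, `G_n = s₀ + δr`.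
Proof as G6: G0 + G2 (`z = Lx`, `ẋ = (A₁₁ + A₁₂L)x`), G1, G4 (`‖L s − M s‖ ≤ re^{−κs}` ⇒ window means `≤ δr/κ`, periodic part `= −PḠ` exactly) and ad-lit's
Besjes/SVM lemma `PeriodicAveraging.norm_sub_exp_apply_le`. [cite: SandersVerhulstMurdock2007, Thm 2.8.1 / Thm 5.5.1 (linear case)] -/
theorem slow_tracking_of_coercive (E F : Type) [NormedAddCommGroup E] [InnerProductSpace ℝ E] [FiniteDimensional ℝ E]
    [NormedAddCommGroup F] [InnerProductSpace ℝ F] [FiniteDimensional ℝ F]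
    (A₁₁ : ℝ → E →L[ℝ] E) (A₁₂ : ℝ → F →L[ℝ] E) (A₂₁ : ℝ → E →L[ℝ] F) (A₂₂ : ℝ → F →L[ℝ] F)
    (M : ℝ → E →L[ℝ] F) (x : ℝ → E) (z : ℝ → F) (γ δ s₀ rlo P T : ℝ)
    (hδ : 0 ≤ δ) (hs₀ : 0 ≤ s₀) (hsγ : s₀ < γ) (h8 : 8 * δ ^ 2 ≤ (γ - s₀) ^ 2) (hP : 0 < P) (hPT : P ≤ T)
    (hA₂₂ : ∀ t ∈ Icc 0 T, ∀ z : F, ⟪A₂₂ t z, z⟫_ℝ ≤ -γ * ‖z‖ ^ 2)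
    (h₁₁ : ∀ t ∈ Icc 0 T, ‖A₁₁ t‖ ≤ s₀) (h₁₂ : ∀ t ∈ Icc 0 T, ‖A₁₂ t‖ ≤ δ) (h₂₁ : ∀ t ∈ Icc 0 T, ‖A₂₁ t‖ ≤ δ)
    (hc₁₁ : ContinuousOn A₁₁ (Icc 0 T)) (hc₁₂ : ContinuousOn A₁₂ (Icc 0 T)) (hc₂₁ : ContinuousOn A₂₁ (Icc 0 T))
    (hc₂₂ : ContinuousOn A₂₂ (Icc 0 T))
    (hp₁₁ : ∀ t, 0 ≤ t → t + P ≤ T → A₁₁ (t + P) = A₁₁ t) (hp₁₂ : ∀ t, 0 ≤ t → t + P ≤ T → A₁₂ (t + P) = A₁₂ t)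
    (hrlo : 0 < rlo)
    (hcoer : ∀ v : E, rlo * ‖v‖ ^ 2 ≤ ⟪(-(1 / P) • ∫ s in (0:ℝ)..P, (A₁₁ s + (A₁₂ s).comp (M s))) v, v⟫_ℝ)
    (hMc : ContinuousOn M (Icc 0 T))
    (hMd : ∀ t ∈ Ico 0 T, HasDerivAt M (A₂₁ t + (A₂₂ t).comp (M t) - (M t).comp (A₁₁ t) - ((M t).comp (A₁₂ t)).comp (M t)) t)
    (hM0 : ‖M 0‖ ≤ 2 * δ / (γ - s₀)) (hMp : ∀ t, 0 ≤ t → t + P ≤ T → M (t + P) = M t)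
    (hx : ∀ t ∈ Ico 0 T, HasDerivAt x (A₁₁ t (x t) + A₁₂ t (z t)) t)
    (hz : ∀ t ∈ Ico 0 T, HasDerivAt z (A₂₁ t (x t) + A₂₂ t (z t)) t)
    (hxc : ContinuousOn x (Icc 0 T)) (hzc : ContinuousOn z (Icc 0 T)) (hz0 : z 0 = 0)
    (Mx : ℝ) (hxM : ∀ s ∈ Icc 0 T, ‖x s‖ ≤ Mx) :
    ∀ t ∈ Ico 0 T, ‖x t - NormedSpace.exp (-(t • (-(1 / P) • ∫ s in (0:ℝ)..P, (A₁₁ s + (A₁₂ s).comp (M s))))) (x 0)‖ ≤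
      Mx * ((δ * (2 * δ / (γ - s₀)) / (((γ - s₀) * (1 - (2 * δ / (γ - s₀)) ^ 2)) * P)) * (min t (1 / rlo) + P) +
        (2 * (s₀ + δ * (2 * δ / (γ - s₀)))) * P *
          (1 + (2 * (s₀ + δ * (2 * δ / (γ - s₀))) + 2 * (s₀ + δ * (2 * δ / (γ - s₀)))) / rlo)) := by
  intro t ht
  have hγ : 0 < γ := lt_of_le_of_lt hs₀ hsγ
  have hgs : 0 < γ - s₀ := by linarith
  have hT : 0 ≤ T := hP.le.trans hPT
  set r := 2 * δ / (γ - s₀) with hr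
  have hr0 : 0 ≤ r := by positivity
  have hr2 : r ^ 2 ≤ 1 / 2 := by
    rw [hr, div_pow, div_le_div_iff₀ (by positivity) (by norm_num)]
    nlinarith
  set κ := (γ - s₀) * (1 - r ^ 2) with hκ
  have hκpos : 0 < κ := mul_pos hgs (by linarith)
  -- G0: the graph from the empty graph; G1: the ball for `L` and `M`
  obtain ⟨L, hL0, hLc, hLd, hLb⟩ := riccatiGraph_exists E F A₁₁ A₁₂ A₂₁ A₂₂ γ δ s₀ T hδ hs₀ hsγ h8 hT hA₂₂ h₁₁ h₁₂ h₂₁ hc₁₁ hc₁₂ hc₂₁ hc₂₂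
  have hMb := riccatiInvariantBall E F A₁₁ A₁₂ A₂₁ A₂₂ M γ δ s₀ T hγ hδ hs₀ hsγ h8 hT hA₂₂ h₁₁ h₁₂ h₂₁ hMd hMc hM0
  -- G2: exact reduction (needs a uniform bound `B`)
  obtain ⟨C₂₂, hC₂₂⟩ := isCompact_Icc.exists_bound_of_continuousOn hc₂₂
  set B := max C₂₂ (max δ r) with hB
  have hBall : ∀ s ∈ Icc 0 T, ‖A₂₂ s‖ ≤ B ∧ ‖A₁₂ s‖ ≤ B ∧ ‖L s‖ ≤ B := fun s hs =>
    ⟨(hC₂₂ s hs).trans (le_max_left _ _), (h₁₂ s hs).trans ((le_max_left _ _).trans (le_max_right _ _)),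
      (hLb s hs).trans ((le_max_right _ _).trans (le_max_right _ _))⟩
  have hLx0 : z 0 = L 0 (x 0) := by rw [hz0, hL0]; rfl
  obtain ⟨_, hxd⟩ := graphReduction E F A₁₁ A₁₂ A₂₁ A₂₂ L x z T B hT hBall hLd hx hz hLc hxc hzc hLx0
  -- G4: the transient `‖L s − M s‖ ≤ r e^{−κ s}`
  have hLM : ∀ s ∈ Icc 0 T, ‖L s - M s‖ ≤ r * Real.exp (-(κ * s)) := by
    intro s hs
    have h := riccati_contraction E F A₁₁ A₁₂ A₂₁ A₂₂ L M γ δ s₀ T hγ hδ hs₀ hsγ h8 hT hA₂₂ h₁₁ h₁₂ h₂₁ hLd hMd hLc hMc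
      (by rw [hL0, norm_zero]; exact hr0) hM0 s hs
    rw [hL0, zero_sub, norm_neg] at h
    calc ‖L s - M s‖ ≤ Real.exp (-((γ - s₀) * (1 - (2 * δ / (γ - s₀)) ^ 2)) * s) * ‖M 0‖ := h
      _ ≤ Real.exp (-((γ - s₀) * (1 - (2 * δ / (γ - s₀)) ^ 2)) * s) * r := mul_le_mul_of_nonneg_left hM0 (Real.exp_pos _).le
      _ = r * Real.exp (-(κ * s)) := by rw [hκ, hr, mul_comm, neg_mul]
  -- the periodic integrand `F s = A₁₁ s + A₁₂ s ∘ M s`, the averaged generator `Ḡ`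
  set Fm : ℝ → E →L[ℝ] E := fun s => A₁₁ s + (A₁₂ s).comp (M s) with hFm
  have hFmc : ContinuousOn Fm (Icc 0 T) := hc₁₁.add (hc₁₂.clm_comp hMc)
  have hFmi : ∀ a b, 0 ≤ a → a ≤ b → b ≤ T → IntervalIntegrable Fm volume a b := fun a b ha hab hb =>
    (hFmc.mono (Icc_subset_Icc ha hb)).intervalIntegrable_of_Icc hab
  have hFmn : ∀ s ∈ Icc 0 T, ‖Fm s‖ ≤ s₀ + δ * r := fun s hs =>
    (norm_add_le _ _).trans (add_le_add (h₁₁ s hs) ((ContinuousLinearMap.opNorm_comp_le _ _).trans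
      (mul_le_mul (h₁₂ s hs) (hMb s hs) (norm_nonneg _) hδ)))
  have hFmp : ∀ s, 0 ≤ s → s + P ≤ T → Fm (s + P) = Fm s := fun s hs hsP => by
    simp only [hFm, hp₁₁ s hs hsP, hp₁₂ s hs hsP, hMp s hs hsP]
  set Gbar : E →L[ℝ] E := -(1 / P) • ∫ s in (0:ℝ)..P, Fm s with hGbar
  have hintF : ∫ s in (0:ℝ)..P, Fm s = -(P • Gbar) := by
    rw [hGbar, smul_smul]; field_simp; simp
  have hGn0 : 0 ≤ s₀ + δ * r := by positivity
  have hGn : ‖Gbar‖ ≤ s₀ + δ * r := by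
    rw [hGbar, norm_smul, norm_neg, Real.norm_eq_abs, abs_of_pos (by positivity : (0:ℝ) < 1 / P)]
    have h := intervalIntegral.norm_integral_le_of_norm_le_const (a := (0:ℝ)) (b := P) (C := s₀ + δ * r) (f := Fm)
      (fun s hs => hFmn s ⟨(uIoc_of_le hP.le ▸ hs).1.le, ((uIoc_of_le hP.le ▸ hs).2).trans hPT⟩)
    rw [sub_zero, abs_of_pos hP] at h
    calc 1 / P * ‖∫ s in (0:ℝ)..P, Fm s‖ ≤ 1 / P * ((s₀ + δ * r) * P) := mul_le_mul_of_nonneg_left h (by positivity)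
      _ = s₀ + δ * r := by field_simp
  have hcoer' : ∀ v : E, rlo * ‖v‖ ^ 2 ≤ ⟪Gbar v, v⟫_ℝ := fun v => by rw [hGbar]; exact hcoer v
  -- time clamp and the perturbation `g`
  set c : ℝ → ℝ := fun s => max 0 (min s T) with hc
  have hc_mem : ∀ s, c s ∈ Icc 0 T := fun s => ⟨le_max_left _ _, max_le hT (min_le_right _ _)⟩
  have hc_id : ∀ s ∈ Icc 0 T, c s = s := fun s hs => by
    show max 0 (min s T) = s
    rw [min_eq_left hs.2, max_eq_right hs.1]
  have hc_cont : Continuous c := continuous_const.max (continuous_id.min continuous_const)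
  set g : ℝ → E →L[ℝ] E := fun s => -(A₁₁ (c s) + (A₁₂ (c s)).comp (L (c s))) - Gbar with hg
  have hgc : Continuous g := by
    have h1 : Continuous fun s => A₁₁ (c s) := hc₁₁.comp_continuous hc_cont hc_mem
    have h2 : Continuous fun s => A₁₂ (c s) := hc₁₂.comp_continuous hc_cont hc_mem
    have h3 : Continuous fun s => L (c s) := hLc.comp_continuous hc_cont hc_mem
    exact (h1.add (h2.clm_comp h3)).neg.sub continuous_const
  have hLg : ∀ s ∈ Icc 0 t, ‖g s‖ ≤ 2 * (s₀ + δ * r) := by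
    intro s _
    have hcs := hc_mem s
    have h1 : ‖A₁₁ (c s) + (A₁₂ (c s)).comp (L (c s))‖ ≤ s₀ + δ * r :=
      (norm_add_le _ _).trans (add_le_add (h₁₁ _ hcs) ((ContinuousLinearMap.opNorm_comp_le _ _).trans
        (mul_le_mul (h₁₂ _ hcs) (hLb _ hcs) (norm_nonneg _) hδ)))
    calc ‖g s‖ ≤ ‖-(A₁₁ (c s) + (A₁₂ (c s)).comp (L (c s)))‖ + ‖Gbar‖ := norm_sub_le _ _
      _ ≤ (s₀ + δ * r) + (s₀ + δ * r) := by rw [norm_neg]; exact add_le_add h1 hGn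
      _ = 2 * (s₀ + δ * r) := by ring
  -- the reduced equation in averaging form
  have hxd' : ∀ s ∈ Icc 0 t, HasDerivAt x (-(Gbar (x s) + g s (x s))) s := by
    intro s hs
    have hsI : s ∈ Ico 0 T := ⟨hs.1, lt_of_le_of_lt hs.2 ht.2⟩
    refine (hxd s hsI).congr_deriv ?_
    simp only [hg, hc_id s (Ico_subset_Icc_self hsI), FunLike.coe_sub, FunLike.coe_add, FunLike.coe_neg, Pi.sub_apply, Pi.add_apply,
      Pi.neg_apply, ContinuousLinearMap.comp_apply]
    abel
  have hxM' : ∀ s ∈ Icc 0 t, ‖x s‖ ≤ Mx := fun s hs => hxM s ⟨hs.1, hs.2.trans ht.2.le⟩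
  -- window means: the periodic part averages to `−PḠ` exactly, the transient `A₁₂(L − M)` to at most `δr/κ`
  have hmean : ∀ n : ℕ, ((n:ℝ) + 1) * P ≤ t →
      ‖∫ s in ((n:ℝ) * P)..(((n:ℝ) + 1) * P), g s‖ ≤ (δ * r / (κ * P)) * P := by
    intro n hn
    have hn0 : 0 ≤ (n:ℝ) * P := by positivity
    have hnle : (n:ℝ) * P ≤ ((n:ℝ) + 1) * P := by nlinarith
    have hn1T : ((n:ℝ) + 1) * P ≤ T := hn.trans ht.2.le
    have hwin : ∀ s ∈ uIcc ((n:ℝ) * P) (((n:ℝ) + 1) * P), s ∈ Icc 0 T := fun s hs => by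
      rw [uIcc_of_le hnle] at hs; exact ⟨hn0.trans hs.1, hs.2.trans hn1T⟩
    -- split `g = (−Fm − Ḡ) − A₁₂ ∘ (L − M)` on the window
    have hsplit : EqOn g (fun s => (-(Fm s) - Gbar) - (A₁₂ s).comp (L s - M s)) (uIcc ((n:ℝ) * P) (((n:ℝ) + 1) * P)) := by
      intro s hs
      have hsT := hwin s hs
      simp only [hg, hFm, hc_id s hsT, ContinuousLinearMap.comp_sub]
      abel
    rw [intervalIntegral.integral_congr hsplit]
    have hiF : IntervalIntegrable Fm volume ((n:ℝ) * P) (((n:ℝ) + 1) * P) := hFmi _ _ hn0 hnle hn1T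
    have hiFn : IntervalIntegrable (fun s => -(Fm s)) volume ((n:ℝ) * P) (((n:ℝ) + 1) * P) := hiF.neg
    have hi1 : IntervalIntegrable (fun s => -(Fm s) - Gbar) volume ((n:ℝ) * P) (((n:ℝ) + 1) * P) :=
      hiFn.sub intervalIntegrable_const
    have hcD : ContinuousOn (fun s => (A₁₂ s).comp (L s - M s)) (Icc 0 T) := hc₁₂.clm_comp (hLc.sub hMc)
    have hi2 : IntervalIntegrable (fun s => (A₁₂ s).comp (L s - M s)) volume ((n:ℝ) * P) (((n:ℝ) + 1) * P) :=
      (hcD.mono (Icc_subset_Icc hn0 hn1T)).intervalIntegrable_of_Icc hnle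
    rw [intervalIntegral.integral_sub hi1 hi2, intervalIntegral.integral_sub hiFn intervalIntegrable_const,
      intervalIntegral.integral_neg, intervalIntegral.integral_const]
    -- periodicity: `∫_{nP}^{(n+1)P} Fm = ∫₀^P Fm = −P Ḡ`
    have hper : ∫ s in ((n:ℝ) * P)..(((n:ℝ) + 1) * P), Fm s = ∫ s in (0:ℝ)..P, Fm s := by
      have h := intervalIntegral.integral_comp_add_right (fun s => Fm s) ((n:ℝ) * P) (a := 0) (b := P)
      rw [zero_add, show P + (n:ℝ) * P = ((n:ℝ) + 1) * P by ring] at h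
      rw [← h]
      refine intervalIntegral.integral_congr fun s hs => ?_
      rw [uIcc_of_le hP.le] at hs
      exact periodic_shift_nat hP.le hFmp n s hs.1 (by nlinarith [hs.2])
    rw [hper, hintF]
    have e0 : -(-(P • Gbar)) - (((n:ℝ) + 1) * P - (n:ℝ) * P) • Gbar = 0 := by
      rw [show ((n:ℝ) + 1) * P - (n:ℝ) * P = P by ring]; simp
    rw [e0, zero_sub, norm_neg]
    -- the transient
    have hbd : ∀ᵐ s ∂volume, s ∈ Ioc ((n:ℝ) * P) (((n:ℝ) + 1) * P) → ‖(A₁₂ s).comp (L s - M s)‖ ≤ δ * r * Real.exp (-(κ * s)) := by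
      refine Filter.Eventually.of_forall fun s hs => ?_
      have hsT : s ∈ Icc 0 T := ⟨hn0.trans hs.1.le, hs.2.trans hn1T⟩
      calc ‖(A₁₂ s).comp (L s - M s)‖ ≤ ‖A₁₂ s‖ * ‖L s - M s‖ := ContinuousLinearMap.opNorm_comp_le _ _
        _ ≤ δ * (r * Real.exp (-(κ * s))) := mul_le_mul (h₁₂ s hsT) (hLM s hsT) (norm_nonneg _) hδ
        _ = δ * r * Real.exp (-(κ * s)) := by ring
    have hie : IntervalIntegrable (fun s => δ * r * Real.exp (-(κ * s))) volume ((n:ℝ) * P) (((n:ℝ) + 1) * P) :=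
      (continuous_const.mul (Real.continuous_exp.comp (continuous_const.mul continuous_id).neg)).intervalIntegrable _ _
    calc ‖∫ s in ((n:ℝ) * P)..(((n:ℝ) + 1) * P), (A₁₂ s).comp (L s - M s)‖
        ≤ ∫ s in ((n:ℝ) * P)..(((n:ℝ) + 1) * P), δ * r * Real.exp (-(κ * s)) := intervalIntegral.norm_integral_le_of_norm_le hnle hbd hie
      _ = δ * r * ∫ s in ((n:ℝ) * P)..(((n:ℝ) + 1) * P), Real.exp (-(κ * s)) := by rw [intervalIntegral.integral_const_mul]
      _ ≤ δ * r * (1 / κ) := mul_le_mul_of_nonneg_left (integral_exp_neg_mul_le hκpos hn0) (by positivity)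
      _ = δ * r / (κ * P) * P := by field_simp
  -- Besjes / Sanders–Verhulst–Murdock averaging (ad-lit `LinearPeriodicAveraging`)
  haveI : CompleteSpace E := FiniteDimensional.complete ℝ E
  have hη : 0 ≤ δ * r / (κ * P) := by positivity
  have key := Literature.Analysis.ODE.PeriodicAveraging.norm_sub_exp_apply_le Gbar hgc x hrlo hP hη ht.1 hcoer' hGn hLg hmean hxd' hxM'
  simpa only [hr, hκ] using key


end TrackingCoercive

/-! ## §15b Consumer lemma: one-sided ODE solutions extend to two-sided ones (amendment 1) -/

section Extension

/-- **Left extension of a right-differentiable curve.**  A curve with derivatives within `[0, T]` on `[0, T)` (what Mathlib's Picard–Lindelöf and the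
tree's Galerkin schemes deliver, e.g. `galerkinCoeff_spec`) agrees on `[0, ∞)` with a curve having TWO-SIDED derivatives on `[0, T)` (affine extension to
the left of `0`), continuous on `[0, T]`.  This is how the block data `x, z` of G2/G6/G6′/G8 — typed with `HasDerivAt` on `Ico 0 T`, as the registered
lever — are produced from one-sided ODE solutions; the equation `ẋ = A₁₁x + A₁₂z` transfers verbatim since the extensions agree with `x, z` on `[0, T]`.
[folklore] -/
theorem exists_twoSided_extension {V : Type*} [NormedAddCommGroup V] [NormedSpace ℝ V] {x : ℝ → V} {F : ℝ → V} {T : ℝ}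
    (hx : ∀ t ∈ Ico 0 T, HasDerivWithinAt x (F t) (Icc 0 T) t) (hxc : ContinuousOn x (Icc 0 T)) :
    ∃ y : ℝ → V, (∀ t, 0 ≤ t → y t = x t) ∧ (∀ t ∈ Ico 0 T, HasDerivAt y (F t) t) ∧ ContinuousOn y (Icc 0 T) := by
  refine ⟨fun t => if 0 ≤ t then x t else x 0 + t • F 0, fun t ht => if_pos ht, fun t ht => ?_,
    hxc.congr fun t ht => if_pos ht.1⟩
  rcases ht.1.eq_or_lt with h0 | hpos
  · -- `t = 0`: glue the right derivative of `x` to the left derivative of the affine extension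
    subst h0
    have hT : (0:ℝ) < T := ht.2
    have hR : HasDerivWithinAt (fun t => if 0 ≤ t then x t else x 0 + t • F 0) (F 0) (Ici 0) 0 := by
      have h1 : HasDerivWithinAt x (F 0) (Ici 0) 0 := (hx 0 ht).mono_of_mem_nhdsWithin (Icc_mem_nhdsGE hT)
      exact h1.congr (fun t ht => if_pos ht) (by simp)
    have hL : HasDerivWithinAt (fun t => if 0 ≤ t then x t else x 0 + t • F 0) (F 0) (Iic 0) 0 := by
      have h2 : HasDerivAt (fun t : ℝ => x 0 + t • F 0) (F 0) 0 := by
        simpa using ((hasDerivAt_id (0:ℝ)).smul_const (F 0)).const_add (x 0)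
      refine h2.hasDerivWithinAt.congr (fun t ht => ?_) (by simp)
      rcases (show t ≤ 0 from ht).eq_or_lt with h | h
      · subst h; simp
      · simp [not_le.mpr h]
    have h := hL.union hR
    rwa [Iic_union_Ici, hasDerivWithinAt_univ] at h
  · -- `0 < t < T`: the extension is `x` near `t`
    have h1 : HasDerivAt x (F t) t := (hx t ht).hasDerivAt (Icc_mem_nhds hpos ht.2)
    refine h1.congr_of_eventuallyEq ?_
    filter_upwards [Ioi_mem_nhds hpos] with s hs
    simp [le_of_lt (show 0 < s from hs)]

end Extension

end SlowGraph

end Summit.AnomalousDissipation.AnomalousDissipation.Theorems.SolenoidalFractalHomogenisation.LagrangianStep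

end
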